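import Literature.MathematicalPhysics.StatisticalMechanics.BarlowCoordination
import Mathlib.Analysis.InnerProductSpace.PiL2
import HarnessLib

/-!
# Covering radius of the close-packed layers of the model fcc lattice: `1/√3`

HONEST FRAMING. Part of the venture `Summits/Ventures/Crystal3D` (cell `crystal3d-full`), helper
`--supports` the crux `NoReconstructionGain` (stmt-Ventures-19144, route
`route-Ventures-StickyWulffConstant`).  Elementary planar geometry of the triangular layers of
`fccStacking 1 √(2/3)` (tree frame: layer `k` is the unit triangular lattice
`{(i + j/2 + k/2, (√3/2)(j + k/3))}` at height `k √(2/3)`); nothing about packings by itself.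

* `sq_add_mul_add_sq_le_third` — barycentric estimate: if `β, γ ≥ 0` are at most the third
  barycentric coordinate `1 − β − γ`, then `β² + βγ + γ² ≤ 1/3` (the squared distance to the
  vertex carrying the largest weight of a unit equilateral triangle is at most the squared
  circumradius).
* `exists_fccSite_planar_sq_le_third` — **covering**: every point of the plane is within planar
  distance `1/√3` of a site of EVERY layer `k` (six cases: lower / upper triangle of the
  fundamental parallelogram × the vertex of largest barycentric weight).
* `hollow_height_sq` — the hollow-site inequality behind the adhesion atom at `(111)`: a point at
  distance `≥ 1` from the covering site of layer `k` is at height-distance `≥ √(2/3)` from the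
  layer (`(Δz)² ≥ 1 − 1/3`).

WHAT THIS IS NOT: nothing about the crux by itself; rung F-C1 not moved.
-/

noncomputable section

namespace Summit.Ventures.Crystal3D.Theorems

open Real
open Literature.MathematicalPhysics.StatisticalMechanics (barlowPos constHagg haggLabel_const
  barlowPos_apply_zero barlowPos_apply_one barlowPos_apply_two)
open scoped InnerProductSpace

/-- Barycentric estimate in the unit equilateral triangle: if the weights `β, γ ≥ 0` are both at
most the third weight `1 − β − γ`, then `β² + βγ + γ² ≤ 1/3`. -/
theorem sq_add_mul_add_sq_le_third {β γ : ℝ} (hβ : 0 ≤ β) (hγ : 0 ≤ γ)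
    (h1 : β ≤ 1 - β - γ) (h2 : γ ≤ 1 - β - γ) : β ^ 2 + β * γ + γ ^ 2 ≤ 1 / 3 := by
  nlinarith [mul_nonneg hβ (show 0 ≤ 1 - 2 * β - γ by linarith),
    mul_nonneg hγ (show 0 ≤ 1 - β - 2 * γ by linarith)]

/-- Planar squared distance in lattice coordinates: the offset `x u + y v` (`u = (1,0)`,
`v = (1/2, √3/2)`) has squared length `x² + xy + y²`. -/
theorem sq_offset_eq (x y : ℝ) :
    (x + y / 2) ^ 2 + (Real.sqrt 3 / 2 * y) ^ 2 = x ^ 2 + x * y + y ^ 2 := by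
  have h3 : Real.sqrt 3 ^ 2 = 3 := Real.sq_sqrt (by norm_num)
  nlinarith [h3]

/-- **Covering radius `1/√3` of every layer.**  For every point `(w₀, w₁)` of the plane and every
layer index `k` there is a site `barlowPos 1 √(2/3) constHagg k i j` of the model fcc lattice at
planar squared distance `≤ 1/3`. -/
theorem exists_fccSite_planar_sq_le_third (w₀ w₁ : ℝ) (k : ℤ) :
    ∃ i j : ℤ, (w₀ - barlowPos 1 (Real.sqrt (2 / 3)) constHagg k i j 0) ^ 2 +
      (w₁ - barlowPos 1 (Real.sqrt (2 / 3)) constHagg k i j 1) ^ 2 ≤ 1 / 3 := by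
  have h3 : (0 : ℝ) < Real.sqrt 3 := Real.sqrt_pos.2 (by norm_num)
  have h3sq : Real.sqrt 3 ^ 2 = 3 := Real.sq_sqrt (by norm_num)
  -- lattice coordinates of `w` relative to layer `k`
  set t : ℝ := 2 / Real.sqrt 3 * w₁ - (k : ℝ) / 3 with ht
  set s : ℝ := w₀ - (k : ℝ) / 2 - t / 2 with hs
  have hw₀ : w₀ = s + t / 2 + (k : ℝ) / 2 := by rw [hs]; ring
  have hw₁ : w₁ = Real.sqrt 3 / 2 * (t + (k : ℝ) / 3) := by
    rw [ht]; field_simp; nlinarith [h3sq]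
  -- planar distance to the site `(i, j)` in terms of `x = s - i`, `y = t - j`
  have hd : ∀ i j : ℤ, (w₀ - barlowPos 1 (Real.sqrt (2 / 3)) constHagg k i j 0) ^ 2 +
      (w₁ - barlowPos 1 (Real.sqrt (2 / 3)) constHagg k i j 1) ^ 2 =
      (s - i) ^ 2 + (s - i) * (t - j) + (t - j) ^ 2 := by
    intro i j
    rw [barlowPos_apply_zero, barlowPos_apply_one, haggLabel_const, hw₀, hw₁]
    have e0 : s + t / 2 + (k : ℝ) / 2 - 1 * ((i : ℝ) + (j : ℝ) / 2 + (k : ℝ) / 2) =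
        (s - i) + (t - j) / 2 := by ring
    have e1 : Real.sqrt 3 / 2 * (t + (k : ℝ) / 3) - 1 * Real.sqrt 3 / 2 * ((j : ℝ) + (k : ℝ) / 3) =
        Real.sqrt 3 / 2 * (t - j) := by ring
    rw [e0, e1, sq_offset_eq]
  set i₀ : ℤ := ⌊s⌋ with hi₀
  set j₀ : ℤ := ⌊t⌋ with hj₀
  set a : ℝ := s - i₀ with ha
  set b : ℝ := t - j₀ with hb
  have ha0 : 0 ≤ a := by rw [ha]; linarith [Int.floor_le s]
  have ha1 : a < 1 := by rw [ha]; linarith [Int.lt_floor_add_one s]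
  have hb0 : 0 ≤ b := by rw [hb]; linarith [Int.floor_le t]
  have hb1 : b < 1 := by rw [hb]; linarith [Int.lt_floor_add_one t]
  by_cases hab : a + b ≤ 1
  · -- lower triangle: vertices `(i₀,j₀)`, `(i₀+1,j₀)`, `(i₀,j₀+1)`, weights `1-a-b, a, b`
    by_cases hA : a ≤ 1 - a - b ∧ b ≤ 1 - a - b
    · refine ⟨i₀, j₀, ?_⟩
      rw [hd]
      have := sq_add_mul_add_sq_le_third ha0 hb0 hA.1 hA.2
      simpa [ha, hb] using this
    · by_cases hB : b ≤ a
      · -- largest weight `a`: vertex `(i₀+1, j₀)`, distance² in `(1-a-b, b)`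
        refine ⟨i₀ + 1, j₀, ?_⟩
        rw [hd]; push_cast
        have h' : (1 - a - b) ^ 2 + (1 - a - b) * b + b ^ 2 ≤ 1 / 3 := by
          have hne : ¬ (a ≤ 1 - a - b) := fun h => hA ⟨h, hB.trans h⟩
          exact sq_add_mul_add_sq_le_third (by linarith) hb0 (by linarith [not_le.1 hne])
            (by linarith)
        have e : (s - ((i₀ : ℝ) + 1)) ^ 2 + (s - ((i₀ : ℝ) + 1)) * (t - j₀) + (t - j₀) ^ 2 =
            (1 - a - b) ^ 2 + (1 - a - b) * b + b ^ 2 := by simp only [ha, hb]; ring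
        rw [e]; exact h'
      · -- largest weight `b`: vertex `(i₀, j₀+1)`
        refine ⟨i₀, j₀ + 1, ?_⟩
        rw [hd]; push_cast
        have hB' := not_le.1 hB
        have h' : (1 - a - b) ^ 2 + (1 - a - b) * a + a ^ 2 ≤ 1 / 3 := by
          have hne : ¬ (b ≤ 1 - a - b) := fun h => hA ⟨hB'.le.trans h, h⟩
          exact sq_add_mul_add_sq_le_third (by linarith) ha0 (by linarith [not_le.1 hne])
            (by linarith)
        have e : (s - (i₀ : ℝ)) ^ 2 + (s - (i₀ : ℝ)) * (t - ((j₀ : ℝ) + 1)) +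
            (t - ((j₀ : ℝ) + 1)) ^ 2 = (1 - a - b) ^ 2 + (1 - a - b) * a + a ^ 2 := by
          simp only [ha, hb]; ring
        rw [e]; exact h'
  · -- upper triangle: vertices `(i₀+1,j₀+1)`, `(i₀,j₀+1)`, `(i₀+1,j₀)`, weights `a+b-1, 1-a, 1-b`
    have hab' := not_le.1 hab
    set a' : ℝ := 1 - a with ha'
    set b' : ℝ := 1 - b with hb'
    have ha'0 : 0 ≤ a' := by rw [ha']; linarith
    have hb'0 : 0 ≤ b' := by rw [hb']; linarith
    by_cases hA : a' ≤ 1 - a' - b' ∧ b' ≤ 1 - a' - b'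
    · refine ⟨i₀ + 1, j₀ + 1, ?_⟩
      rw [hd]; push_cast
      have h' := sq_add_mul_add_sq_le_third ha'0 hb'0 hA.1 hA.2
      have e : (s - ((i₀ : ℝ) + 1)) ^ 2 + (s - ((i₀ : ℝ) + 1)) * (t - ((j₀ : ℝ) + 1)) +
          (t - ((j₀ : ℝ) + 1)) ^ 2 = a' ^ 2 + a' * b' + b' ^ 2 := by
        simp only [ha', hb', ha, hb]; ring
      rw [e]; exact h'
    · by_cases hB : b' ≤ a'
      · -- largest weight `a' = 1 - a`, carried by vertex `(i₀, j₀+1)`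
        refine ⟨i₀, j₀ + 1, ?_⟩
        rw [hd]; push_cast
        have hne : ¬ (a' ≤ 1 - a' - b') := fun h => hA ⟨h, hB.trans h⟩
        have h' : (1 - a' - b') ^ 2 + (1 - a' - b') * b' + b' ^ 2 ≤ 1 / 3 :=
          sq_add_mul_add_sq_le_third (by simp only [ha', hb']; linarith) hb'0
            (by linarith [not_le.1 hne]) (by linarith)
        have e : (s - (i₀ : ℝ)) ^ 2 + (s - (i₀ : ℝ)) * (t - ((j₀ : ℝ) + 1)) +
            (t - ((j₀ : ℝ) + 1)) ^ 2 = (1 - a' - b') ^ 2 + (1 - a' - b') * b' + b' ^ 2 := by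
          simp only [ha', hb', ha, hb]; ring
        rw [e]; exact h'
      · -- largest weight `b' = 1 - b`, carried by vertex `(i₀+1, j₀)`
        refine ⟨i₀ + 1, j₀, ?_⟩
        rw [hd]; push_cast
        have hB' := not_le.1 hB
        have hne : ¬ (b' ≤ 1 - a' - b') := fun h => hA ⟨hB'.le.trans h, h⟩
        have h' : (1 - a' - b') ^ 2 + (1 - a' - b') * a' + a' ^ 2 ≤ 1 / 3 :=
          sq_add_mul_add_sq_le_third (by simp only [ha', hb']; linarith) ha'0
            (by linarith [not_le.1 hne]) (by linarith)
        have e : (s - ((i₀ : ℝ) + 1)) ^ 2 + (s - ((i₀ : ℝ) + 1)) * (t - (j₀ : ℝ)) +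
            (t - (j₀ : ℝ)) ^ 2 = (1 - a' - b') ^ 2 + (1 - a' - b') * a' + a' ^ 2 := by
          simp only [ha', hb', ha, hb]; ring
        rw [e]; exact h'

/-- **Hollow-site inequality.**  If a point `q` of `ℝ³` is at distance `≥ 1` from the covering
site of layer `k` given by `exists_fccSite_planar_sq_le_third`, then its height differs from the
layer height `k √(2/3)` by at least `√(2/3)` in square: `2/3 ≤ (q₂ − k√(2/3))²`.  (Over a complete
hexagonal layer the lowest admissible positions are the hollow sites, at height `√(2/3)`.) -/
theorem hollow_height_sq (q : EuclideanSpace ℝ (Fin 3)) (k i j : ℤ)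
    (hplanar : (q 0 - barlowPos 1 (Real.sqrt (2 / 3)) constHagg k i j 0) ^ 2 +
      (q 1 - barlowPos 1 (Real.sqrt (2 / 3)) constHagg k i j 1) ^ 2 ≤ 1 / 3)
    (hfar : 1 ≤ dist q (barlowPos 1 (Real.sqrt (2 / 3)) constHagg k i j)) :
    2 / 3 ≤ (q 2 - (k : ℝ) * Real.sqrt (2 / 3)) ^ 2 := by
  have hd : dist q (barlowPos 1 (Real.sqrt (2 / 3)) constHagg k i j) ^ 2 =
      (q 0 - barlowPos 1 (Real.sqrt (2 / 3)) constHagg k i j 0) ^ 2 +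
      (q 1 - barlowPos 1 (Real.sqrt (2 / 3)) constHagg k i j 1) ^ 2 +
      (q 2 - (k : ℝ) * Real.sqrt (2 / 3)) ^ 2 := by
    rw [EuclideanSpace.dist_eq, Real.sq_sqrt (Finset.sum_nonneg fun _ _ => sq_nonneg _),
      Fin.sum_univ_three]
    simp only [Real.dist_eq, sq_abs, barlowPos_apply_two]
  have h1 : 1 ≤ dist q (barlowPos 1 (Real.sqrt (2 / 3)) constHagg k i j) ^ 2 := by nlinarith
  rw [hd] at h1
  linarith

end Summit.Ventures.Crystal3D.Theorems

end
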